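import Literature.AlgebraicGeometry.Resolution.LogRegularAtlas
import Mathlib.AlgebraicGeometry.Noetherian
import HarnessLib

/-!
# Log-regular atlases: the trivial atlas of a regular scheme, and gluing local charts
# (Kato 1994, (1.5) condition (S), Def. (2.1), (2.2)(1))

Topic: `Literature/AlgebraicGeometry/Resolution`. Companion to `LogRegularAtlas.lean`, which
defines a **log-regular Zariski fs atlas** on a scheme (`LogRegularAtlas X`: finitely many affine
opens with fs charts, log regular at every prime in the sense of Kato's Def. (2.1)
`LogChart.IsLogRegularAt`, defining the same log structure on overlaps via `chartStalkMonoid`)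
and vendors Kato's resolution theorem (10.4) in that language. This file supplies the two
pieces of bookkeeping every user of the atlas needs:

* `logRegularAtlas_of_isRegular` — **Kato (2.2)(1)**: a quasi-compact, locally Noetherian,
  regular scheme carries the TRIVIAL log-regular atlas (charts `n = 0`, `P = ℤ⁰`, `φ = 1`; log
  regular at `𝔭` iff the localisation is regular, `LogChart.isLogRegularAt_trivial_iff`; all
  stalk monoids are the units, `chartStalkMonoid_one`).
* `LocalLogRegularChart X M x` and `logRegularAtlas_of_localLogRegularChart` — **gluing, Kato
  (1.5) (S)**: a local log-regular chart at `x` for a PRESCRIBED family of stalk monoids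
  `M y ⊆ 𝒪_{X,y}` (the intended log structure, e.g. the divisorial one of a boundary divisor) is
  an affine open `U ∋ x` with one fs chart, log regular at every prime of `Γ(X, U)`, whose stalk
  monoids at all points of `U` are the prescribed ones; on a quasi-compact locally Noetherian
  scheme, such charts at every point give a `LogRegularAtlas` (finite subcover; compatibility
  holds because both stalk monoids are `M y`). Conversely an atlas gives local charts for the
  family of its own stalk monoids (`localLogRegularChart_of_logRegularAtlas`).

Design note. Prescribing the stalk monoids is what makes the pointwise condition glue: two fs
charts around `y` define the same log structure iff they generate, together with the units, the
same submonoid of `𝒪_{X,y}` (for log regular structures `M_y → 𝒪_{X,y}` is injective, Nizioł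
2006 Lemma 2.4(1)), so fixing that submonoid in advance (`M y`) decouples the charts.

What is NOT here: no construction of charts for any particular scheme beyond the regular case;
no divisorial monoid of a divisor (users supply `M`).

Sources: [Kato1994] K. Kato, *Toric singularities*, Amer. J. Math. 116 (1994): (1.5) (S),
Def. (2.1), (2.2)(1). [Niziol2006] W. Nizioł, *Toric singularities: log-blow-ups and global
resolutions*, J. Algebraic Geom. 15 (2006): §2.1, Lemma 2.4.
-/

noncomputable section

open AlgebraicGeometry TopologicalSpace CategoryTheory Opposite

namespace Literature.AlgebraicGeometry.Resolution

universe u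

/-! ## The trivial log-regular atlas on a regular scheme (Kato 1994, (2.2)(1)) -/

/-- On a regular scheme, the localisation of the coordinate ring of an affine open `U` at any
prime `𝔭` is a regular local ring: it is the local ring `𝒪_{X,x}` at the point `x ∈ U`
corresponding to `𝔭` (`IsAffineOpen.isLocalization_stalk`). [folklore] -/
theorem isRegularLocalRing_localization_of_isRegular {X : Scheme.{u}} (hX : Scheme.IsRegular X)
    (U : X.affineOpens) (𝔭 : Ideal Γ(X, (U : X.Opens))) [𝔭.IsPrime] :
    IsRegularLocalRing (Localization.AtPrime 𝔭) := by
  obtain ⟨y, hy⟩ : ∃ y : (U : X.Opens), U.2.primeIdealOf y = ⟨𝔭, inferInstance⟩ :=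
    ⟨⟨U.2.fromSpec ⟨𝔭, inferInstance⟩, U.2.range_fromSpec.le ⟨_, rfl⟩⟩, by
      apply U.2.fromSpec.isOpenEmbedding.injective
      rw [U.2.fromSpec_primeIdealOf]⟩
  haveI := U.2.isLocalization_stalk y
  haveI := hX (y : X)
  have e := (IsLocalization.algEquiv (U.2.primeIdealOf y).asIdeal.primeCompl
    (X.presheaf.stalk (y : X)) (Localization.AtPrime (U.2.primeIdealOf y).asIdeal)).toRingEquiv
  rw [hy] at e
  exact IsRegularLocalRing.of_ringEquiv e

/-- The stalk monoid of the trivial chart `φ = 1` at any point is the group of units of the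
local ring (the trivial log structure). [cite: Kato1994, (2.2)(1)] -/
theorem chartStalkMonoid_one {X : Scheme.{u}} (U : X.Opens) {P : Type*} [MulOneClass P]
    (x : X) (hx : x ∈ U) :
    chartStalkMonoid U (1 : P →* Γ(X, U)) x hx = IsUnit.submonoid (X.presheaf.stalk x) := by
  rw [chartStalkMonoid]
  refine sup_eq_left.mpr (Submonoid.map_le_iff_le_comap.mpr ?_)
  rintro _ ⟨m, rfl⟩
  simp

/-- A quasi-compact scheme has a finite cover by affine opens (indexed by some `Fin m`).
[folklore] -/
theorem exists_finite_affine_cover (X : Scheme.{u}) [CompactSpace X] :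
    ∃ (m : ℕ) (U : Fin m → X.affineOpens), ⨆ i, (U i : X.Opens) = ⊤ := by
  obtain ⟨s, hs⟩ := isCompact_univ.elim_finite_subcover
    (fun U : X.affineOpens => ((U : X.Opens) : Set X))
    (fun U => (U : X.Opens).isOpen) (fun x _ => by
      obtain ⟨_, ⟨U, hU, rfl⟩, hxU, -⟩ :=
        X.isBasis_affineOpens.exists_subset_of_mem_open (Set.mem_univ x) isOpen_univ
      exact Set.mem_iUnion.mpr ⟨⟨U, hU⟩, hxU⟩)
  obtain ⟨m, ⟨e⟩⟩ := Finite.exists_equiv_fin (s : Set X.affineOpens)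
  refine ⟨m, fun i => (e.symm i).1, ?_⟩
  refine top_le_iff.mp fun x _ => ?_
  have hx := hs (Set.mem_univ x)
  simp only [Set.mem_iUnion] at hx
  obtain ⟨U, hU, hxU⟩ := hx
  exact Opens.mem_iSup.mpr ⟨e ⟨U, hU⟩, by simpa using hxU⟩

/-- **A quasi-compact, locally Noetherian, regular scheme carries a log-regular atlas** — the
trivial one: finitely many affine opens, each with the trivial chart (`n = 0`, `P = ℤ⁰`,
`φ = 1`), which is log regular at a prime `𝔭` iff the localisation at `𝔭` is regular
(Kato 1994, (2.2)(1), `LogChart.isLogRegularAt_trivial_iff`); all stalk monoids are the units,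
so the charts are compatible. [cite: Kato1994, (2.2)(1)] -/
theorem logRegularAtlas_of_isRegular (X : Scheme.{u}) [CompactSpace X] [IsLocallyNoetherian X]
    (hX : Scheme.IsRegular X) : Nonempty (LogRegularAtlas X) := by
  obtain ⟨m, U, hU⟩ := exists_finite_affine_cover X
  exact ⟨{ ι := Fin m
           finite := inferInstance
           U := U
           iSup_eq_top := hU
           isNoetherianRing := fun i => IsLocallyNoetherian.component_noetherian (U i)
           n := fun _ => 0
           P := fun _ => ⊤
           fg := fun _ => (AddSubmonoid.fg_iff _).mpr
             ⟨_, AddSubmonoid.closure_eq ⊤, Set.toFinite _⟩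
           saturated := fun _ _ _ _ _ => trivial
           span_eq_top := fun _ => by simp
           φ := fun _ => 1
           isLogRegularAt := fun i 𝔭 _ => (LogChart.isLogRegularAt_trivial_iff _ _ _).mpr
             (isRegularLocalRing_localization_of_isRegular hX (U i) 𝔭)
           compat := fun i j x hi hj => by rw [chartStalkMonoid_one, chartStalkMonoid_one] }⟩

/-! ## Gluing local log-regular charts with prescribed stalk monoids (Kato 1994, (1.5) (S)) -/

/-- **A local log-regular chart at `x` with prescribed stalk monoids.** `M y ⊆ 𝒪_{X,y}` is the
intended log structure (a family of submonoids of the local rings — in the application, the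
divisorial log structure of a boundary: germs invertible off the boundary); the structure
records an affine open neighbourhood `U ∋ x` with ONE fs chart `φ : P → Γ(X, U)` (`P ⊆ ℤⁿ`
finitely generated, saturated, spanning), log regular at every prime of `Γ(X, U)` (Kato 1994,
Def. (2.1), `LogChart.IsLogRegularAt`), whose stalk monoids at all points of `U` are the
prescribed ones. A family of these over all `x` is Kato's condition (S) of (1.5) together with
(2.1) at every point, for the log structure `M`. [cite: Kato1994, (1.5) and Def. (2.1)] -/
structure LocalLogRegularChart (X : Scheme.{u}) (M : ∀ x : X, Submonoid (X.presheaf.stalk x))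
    (x : X) where
  /-- the affine open carrying the chart -/
  U : X.affineOpens
  /-- it contains `x` -/
  mem : x ∈ (U : X.Opens)
  /-- rank of the ambient lattice -/
  n : ℕ
  /-- the fs monoid, inside `ℤⁿ` -/
  P : AddSubmonoid (Fin n → ℤ)
  /-- the chart -/
  φ : Multiplicative P →* Γ(X, (U : X.Opens))
  /-- finitely generated -/
  fg : P.FG
  /-- saturated in `ℤⁿ` -/
  saturated : ∀ (v : Fin n → ℤ) (k : ℕ), 0 < k → k • v ∈ P → v ∈ P
  /-- spanning `ℤⁿ` -/
  span_eq_top : Submodule.span ℤ (P : Set (Fin n → ℤ)) = ⊤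
  /-- log regular at every prime (Kato Def. (2.1)) -/
  isLogRegularAt : ∀ (𝔭 : Ideal Γ(X, (U : X.Opens))) [𝔭.IsPrime], LogChart.IsLogRegularAt P φ 𝔭
  /-- the stalk monoids are the prescribed ones -/
  chartStalkMonoid_eq : ∀ (y : X) (hy : y ∈ (U : X.Opens)),
    chartStalkMonoid (U : X.Opens) φ y hy = M y

/-- **Gluing**: local log-regular charts with prescribed stalk monoids at every point of a
quasi-compact locally Noetherian scheme give a log-regular atlas (`LogRegularAtlas`): extract a
finite subcover of the chart domains; the compatibility of two charts at a common point holds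
because both stalk monoids equal the prescribed `M x`. [cite: Kato1994, (1.5) and Def. (2.1)] -/
theorem logRegularAtlas_of_localLogRegularChart (X : Scheme.{u}) [CompactSpace X]
    [IsLocallyNoetherian X] (M : ∀ x : X, Submonoid (X.presheaf.stalk x))
    (h : ∀ x : X, Nonempty (LocalLogRegularChart X M x)) : Nonempty (LogRegularAtlas X) := by
  let c : ∀ x, LocalLogRegularChart X M x := fun x => Classical.choice (h x)
  obtain ⟨s, hs⟩ := isCompact_univ.elim_finite_subcover
    (fun x : X => (((c x).U : X.Opens) : Set X)) (fun x => ((c x).U : X.Opens).isOpen)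
    (fun x _ => Set.mem_iUnion.mpr ⟨x, (c x).mem⟩)
  obtain ⟨m, ⟨e⟩⟩ := Finite.exists_equiv_fin (s : Set X)
  have hcov : ⨆ i : Fin m, ((c (e.symm i).1).U : X.Opens) = ⊤ := by
    refine top_le_iff.mp fun x _ => ?_
    have hx := hs (Set.mem_univ x)
    simp only [Set.mem_iUnion] at hx
    obtain ⟨y, hy, hxy⟩ := hx
    exact Opens.mem_iSup.mpr ⟨e ⟨y, hy⟩, by rw [Equiv.symm_apply_apply]; exact hxy⟩
  exact ⟨{ ι := Fin m
           finite := inferInstance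
           U := fun i => (c (e.symm i).1).U
           iSup_eq_top := hcov
           isNoetherianRing := fun i => IsLocallyNoetherian.component_noetherian _
           n := fun i => (c (e.symm i).1).n
           P := fun i => (c (e.symm i).1).P
           fg := fun i => (c _).fg
           saturated := fun i => (c _).saturated
           span_eq_top := fun i => (c _).span_eq_top
           φ := fun i => (c (e.symm i).1).φ
           isLogRegularAt := fun i 𝔭 _ => (c _).isLogRegularAt 𝔭
           compat := fun i j x hi hj => by
             rw [(c _).chartStalkMonoid_eq, (c _).chartStalkMonoid_eq] }⟩

/-- Conversely, a log-regular atlas gives local log-regular charts at every point for the family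
of its own stalk monoids (well defined by `compat`; at each point take the chart of some member
of the cover containing it). [cite: Kato1994, (1.5) and Def. (2.1)] -/
theorem localLogRegularChart_of_logRegularAtlas {X : Scheme.{u}} (𝒜 : LogRegularAtlas X) :
    ∃ M : ∀ x : X, Submonoid (X.presheaf.stalk x), ∀ x, Nonempty (LocalLogRegularChart X M x) := by
  have hmem : ∀ x : X, ∃ i, x ∈ (𝒜.U i : X.Opens) := fun x =>
    Opens.mem_iSup.mp (by rw [𝒜.iSup_eq_top]; trivial)
  choose i hi using hmem
  refine ⟨fun x => chartStalkMonoid (𝒜.U (i x) : X.Opens) (𝒜.φ (i x)) x (hi x), fun x => ⟨?_⟩⟩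
  exact { U := 𝒜.U (i x), mem := hi x, n := 𝒜.n (i x), P := 𝒜.P (i x), φ := 𝒜.φ (i x),
          fg := 𝒜.fg _, saturated := 𝒜.saturated _, span_eq_top := 𝒜.span_eq_top _,
          isLogRegularAt := fun 𝔭 _ => 𝒜.isLogRegularAt _ 𝔭,
          chartStalkMonoid_eq := fun y hy => 𝒜.compat (i x) (i y) y hy (hi y) }

end Literature.AlgebraicGeometry.Resolution

end
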